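import Summits.Ventures.LatticeQCDFlow.Scaling.CycleStepFormBound

/-!
HONEST FRAMING: exact (Metropolis-corrected) sampling algorithms for lattice gauge theory; figures
of merit are autocorrelation/cost numbers at stated couplings and volumes; no continuum-physics
claim.

# StepChainSpectralBound — THE STEP CHAIN `S = σA + (1−σ)B` HAS DIRICHLET FORM `⟨f,(I−S)f⟩_π ≥ (1−σ)(1−θ)‖f‖²_π` AND `⟨f,Sf⟩_π ≥ −σ‖f‖²_π` ON MEAN-ZERO `f`, HENCE EVERY EIGENVALUE
# `λ ≠ 1` WITH A MEAN-ZERO EIGENFUNCTION LIES IN `[−σ, 1 − (1−σ)(1−θ)]` — THE SPECTRAL GAP OF THE STEP CHAIN IS AT LEAST `(1−σ)·(1−θ)`, `θ` THE DECAY RATE OF THE CYCLE CHAIN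
# (OPEN-MATH ITEM 1 (i) (b), ROUTE (α); lean-2 GEN-38, ours)

Venture-side (OURS).  Cell `lqcd-flow` (pub-lqcd), unit `pub-lqcd-lean-2-g38`, 2026-08-30.  Chapter X (item 1 (i) (b)), file 3.  Setting of files X1–X2: `A ≥ 0` stochastic and reversible w.r.t.
`π > 0`, `U` its resolvent at odds `σ ∈ [0,1)`, `B` stochastic-free (only reversible and idempotent are used), the cycle kernel `C = UB` with powers and the decay
`Σ_y|C^n(x,y) − π_C(y)| ≤ 2C₀θⁿ`, `0 < θ`; the step kernel `S = σA + (1−σ)B` (hypothesis-equation).  For `f` with `Σπf = 0` put `g = (f − σAf)/(1−σ)`: then `Ug = f` (X1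
`resolventKernel_right`), `Σπg = 0` (stationarity of `π` for `A`), and `⟨f,(I−S)f⟩_π = (1−σ)[⟨g,Ug⟩_π − ‖Bf‖²_π] ≥ (1−σ)(1−θ)⟨g,Ug⟩_π ≥ (1−σ)(1−θ)‖f‖²_π` by X2 `cycleStep_form_bound` and X1
`resolventKernel_form_ge_normSq` (**`stepChain_dirichlet_ge`**); `⟨f,Sf⟩_π ≥ −σ‖f‖²_π` from `⟨f,Af⟩_π ≥ −‖f‖²_π` (**`stepChain_form_ge_neg`**); so a real eigenfunction `Sf = λf` with
`Σπf = 0`, `f ≠ 0` has **`−σ ≤ λ ≤ 1 − (1−σ)(1−θ)`** (`stepChain_eigenvalue_bounds`).  File X4 turns this into `λ⋆`, `t_rel` and the mixing time in steps through the tree's spectral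
files; files X5–X7 supply the lumped star's objects (swap step, redraw, stationary law, `UB =` W27's cycle chain, irreducibility).  Hypothesis-equations, no definitions.

## What is proved

* `kernel_form_ge_neg` (`⟨f,Af⟩_π ≥ −‖f‖²_π`), `stepChain_preimage` (`Ug = f`, `Σπg = 0` for `g = (f − σAf)/(1−σ)`), **`stepChain_dirichlet_ge`**, **`stepChain_form_ge_neg`**,
  **`stepChain_eigenvalue_bounds`**.

Reading (no numerics implied): `I − S = (I − σA) − (1−σ)B = (1−σ)(U⁻¹ − B)`; the bound is the form version of `U^{1/2}BU^{1/2} ≤ θ` on `1^⊥` plus `U ≤ I`.  Literature grade (cell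
rule): OWN, elementary; nothing cited as a fact; no new bib keys.
-/

open Finset

namespace Summit.Ventures.LatticeQCDFlow.Scaling

section StepSpectral
variable {X : Type*} [Fintype X] [DecidableEq X]
variable {π : X → ℝ} {A U B C S : X → X → ℝ} {σ : ℝ} {Cp : ℕ → X → X → ℝ} {πC : X → ℝ} {C₀ θ : ℝ}

omit [DecidableEq X] in
/-- `⟨f,Af⟩_π ≥ −‖f‖²_π` for `A ≥ 0` stochastic and reversible w.r.t. `π ≥ 0`. [ours] -/
theorem kernel_form_ge_neg (hrev : ∀ x y, π x * A x y = π y * A y x) (hA0 : ∀ x y, 0 ≤ A x y) (hA1 : ∀ x, ∑ y, A x y = 1) (hπ0 : ∀ x, 0 ≤ π x) (f : X → ℝ) :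
    -(∑ x, π x * f x ^ 2) ≤ ∑ x, π x * f x * ∑ y, A x y * f y := by
  -- `0 ≤ Σ_x Σ_y π(x)A(x,y)(f(x)+f(y))² = 2‖f‖² + 2⟨f,Af⟩`
  have h0 : 0 ≤ ∑ x, ∑ y, π x * A x y * (f x + f y) ^ 2 := sum_nonneg fun x _ => sum_nonneg fun y _ => mul_nonneg (mul_nonneg (hπ0 x) (hA0 x y)) (sq_nonneg _)
  have e1 : ∑ x, ∑ y, π x * A x y * f x ^ 2 = ∑ x, π x * f x ^ 2 := sum_congr rfl fun x _ => by rw [← sum_mul, ← mul_sum, hA1, mul_one]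
  have e2 : ∑ x, ∑ y, π x * A x y * f y ^ 2 = ∑ x, π x * f x ^ 2 := by
    rw [sum_comm]; refine sum_congr rfl fun y _ => ?_
    calc ∑ x, π x * A x y * f y ^ 2 = ∑ x, π y * A y x * f y ^ 2 := sum_congr rfl fun x _ => by rw [hrev x y]
      _ = π y * f y ^ 2 := by rw [← sum_mul, ← mul_sum, hA1, mul_one]
  have e3 : ∑ x, ∑ y, π x * A x y * (f x * f y) = ∑ x, π x * f x * ∑ y, A x y * f y :=
    sum_congr rfl fun x _ => by rw [mul_sum]; exact sum_congr rfl fun y _ => by ring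
  have e : ∑ x, ∑ y, π x * A x y * (f x + f y) ^ 2 = 2 * ∑ x, π x * f x ^ 2 + 2 * ∑ x, π x * f x * ∑ y, A x y * f y := by
    rw [← e3]
    have : ∀ x y, π x * A x y * (f x + f y) ^ 2 = π x * A x y * f x ^ 2 + π x * A x y * f y ^ 2 + 2 * (π x * A x y * (f x * f y)) := fun x y => by ring
    simp only [this, sum_add_distrib, ← mul_sum]
    rw [e1, e2]; ring
  linarith [e ▸ h0]

/-- **The preimage under `U`:** for `g = (f − σAf)/(1−σ)`, `Ug = f` and, if `Σπf = 0`, `Σπg = 0`. [ours] -/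
theorem stepChain_preimage (hA0 : ∀ x y, 0 ≤ A x y) (hA1 : ∀ x, ∑ y, A x y = 1) (hrev : ∀ x y, π x * A x y = π y * A y x)
    (hσ0 : 0 ≤ σ) (hσ1 : σ < 1) (hU : ∀ x y, U x y = (1 - σ) * (if x = y then 1 else 0) + σ * ∑ z, A x z * U z y)
    (f : X → ℝ) {g : X → ℝ} (hg : ∀ x, g x = (f x - σ * ∑ y, A x y * f y) / (1 - σ)) :
    (∀ x, ∑ y, U x y * g y = f x) ∧ (∑ x, π x * f x = 0 → ∑ x, π x * g x = 0) := by
  have h1σ : (1 - σ) ≠ 0 := by linarith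
  have hright := resolventKernel_right hA0 hA1 hσ0 hσ1 hU
  constructor
  · intro x
    -- `Σ_y U(x,y)(f y − σ(Af)(y)) = Σ_y U(x,y)f(y) − Σ_z [σ(UA)(x,z)] f z = (1−σ) f x`
    have e1 : ∑ y, U x y * g y = (∑ y, U x y * f y - σ * ∑ z, (∑ y, U x y * A y z) * f z) / (1 - σ) := by
      simp only [hg]
      rw [show (∑ y, U x y * ((f y - σ * ∑ z, A y z * f z) / (1 - σ))) = (∑ y, (U x y * f y - σ * (U x y * ∑ z, A y z * f z))) / (1 - σ) from by
        rw [sum_div]; exact sum_congr rfl fun y _ => by ring]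
      congr 1
      rw [sum_sub_distrib, ← mul_sum]
      congr 2
      rw [show (∑ y, U x y * ∑ z, A y z * f z) = ∑ y, ∑ z, U x y * A y z * f z from sum_congr rfl fun y _ => by rw [mul_sum]; exact sum_congr rfl fun z _ => by ring,
        sum_comm]
      exact sum_congr rfl fun z _ => by rw [sum_mul]
    have e2 : ∀ z, σ * ∑ y, U x y * A y z = U x z - (1 - σ) * (if x = z then 1 else 0) := fun z => by rw [hright x z]; ring
    rw [e1]
    rw [show σ * ∑ z, (∑ y, U x y * A y z) * f z = ∑ z, (σ * ∑ y, U x y * A y z) * f z from by rw [mul_sum]; exact sum_congr rfl fun z _ => by ring]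
    rw [show (∑ z, (σ * ∑ y, U x y * A y z) * f z) = ∑ z, (U x z - (1 - σ) * (if x = z then (1:ℝ) else 0)) * f z from
      sum_congr rfl fun z _ => by rw [e2 z]]
    have e3 : ∑ z, (U x z - (1 - σ) * (if x = z then (1:ℝ) else 0)) * f z = ∑ z, U x z * f z - (1 - σ) * f x := by
      rw [show (∑ z, (U x z - (1 - σ) * (if x = z then (1:ℝ) else 0)) * f z) = ∑ z, (U x z * f z - (if x = z then (1 - σ) * f z else 0)) from
        sum_congr rfl fun z _ => by split_ifs <;> ring, sum_sub_distrib]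
      simp
    rw [e3]
    field_simp
    ring
  · intro hf0
    -- stationarity of `π` for `A`
    have hstat : ∀ y, ∑ x, π x * A x y = π y := fun y => by
      rw [sum_congr rfl fun x _ => hrev x y, ← mul_sum, hA1, mul_one]
    have : ∑ x, π x * g x = (∑ x, π x * f x - σ * ∑ y, π y * f y) / (1 - σ) := by
      simp only [hg]
      rw [show (∑ x, π x * ((f x - σ * ∑ y, A x y * f y) / (1 - σ))) = (∑ x, (π x * f x - σ * (π x * ∑ y, A x y * f y))) / (1 - σ) from by
        rw [sum_div]; exact sum_congr rfl fun x _ => by ring]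
      congr 1
      rw [sum_sub_distrib, ← mul_sum]
      congr 2
      rw [show (∑ x, π x * ∑ y, A x y * f y) = ∑ x, ∑ y, π x * A x y * f y from sum_congr rfl fun x _ => by rw [mul_sum]; exact sum_congr rfl fun y _ => by ring, sum_comm]
      exact sum_congr rfl fun y _ => by rw [← sum_mul, hstat y]
    rw [this, hf0]; simp

/-- **THE DIRICHLET-FORM BOUND FOR THE STEP CHAIN:** with `S = σA + (1−σ)B` and the decay `θ` of `C = UB` (files X1–X2), every `f` with `Σπf = 0` satisfies
**`⟨f,(I−S)f⟩_π ≥ (1−σ)(1−θ)·‖f‖²_π`**. [ours] -/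
theorem stepChain_dirichlet_ge [Nonempty X] (hπ : ∀ x, 0 < π x) (hA0 : ∀ x y, 0 ≤ A x y) (hA1 : ∀ x, ∑ y, A x y = 1) (hrev : ∀ x y, π x * A x y = π y * A y x)
    (hσ0 : 0 ≤ σ) (hσ1 : σ < 1) (hU : ∀ x y, U x y = (1 - σ) * (if x = y then 1 else 0) + σ * ∑ z, A x z * U z y)
    (hBrev : ∀ x y, π x * B x y = π y * B y x) (hBB : ∀ x y, ∑ z, B x z * B z y = B x y)
    (hC : ∀ x y, C x y = ∑ z, U x z * B z y) (hCp0 : ∀ x y, Cp 0 x y = if x = y then 1 else 0) (hCpS : ∀ n x y, Cp (n + 1) x y = ∑ z, Cp n x z * C z y)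
    (hθ0 : 0 < θ) (hθ1 : θ ≤ 1) (hdec : ∀ n x, ∑ y, |Cp n x y - πC y| ≤ 2 * C₀ * θ ^ n)
    (hS : ∀ x y, S x y = σ * A x y + (1 - σ) * B x y) (f : X → ℝ) (hf0 : ∑ x, π x * f x = 0) :
    (1 - σ) * (1 - θ) * ∑ x, π x * f x ^ 2 ≤ ∑ x, π x * f x * (f x - ∑ y, S x y * f y) := by
  set g : X → ℝ := fun x => (f x - σ * ∑ y, A x y * f y) / (1 - σ) with hgdef
  obtain ⟨hUg, hg0'⟩ := stepChain_preimage hA0 hA1 hrev hσ0 hσ1 hU f (g := g) (fun x => rfl)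
  have hg0 := hg0' hf0
  have h1σ : 0 < 1 - σ := by linarith
  -- `⟨f,(I−S)f⟩ = (1−σ)(⟨f,g⟩ − ⟨f,Bf⟩)`
  have e1 : ∑ x, π x * f x * (f x - ∑ y, S x y * f y) = (1 - σ) * (∑ x, π x * f x * g x - ∑ x, π x * f x * ∑ y, B x y * f y) := by
    rw [mul_sub, mul_sum, mul_sum, ← sum_sub_distrib]
    refine sum_congr rfl fun x _ => ?_
    have eS : ∑ y, S x y * f y = σ * ∑ y, A x y * f y + (1 - σ) * ∑ y, B x y * f y := by
      rw [mul_sum, mul_sum, ← sum_add_distrib]; exact sum_congr rfl fun y _ => by rw [hS]; ring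
    rw [eS, hgdef]
    field_simp
    ring
  -- `⟨f,g⟩ = ⟨g,Ug⟩`, `⟨f,Bf⟩ = ‖Bf‖² = ‖BUg‖²`
  have e2 : ∑ x, π x * f x * g x = ∑ x, π x * g x * ∑ y, U x y * g y := sum_congr rfl fun x _ => by rw [hUg x]; ring
  have e3 : ∑ x, π x * f x * ∑ y, B x y * f y = ∑ x, π x * (∑ y, B x y * ∑ w, U y w * g w) ^ 2 := by
    rw [idem_form_eq_normSq hBrev hBB f]; simp only [hUg]
  have hform := cycleStep_form_bound hπ hA0 hA1 hrev hσ0 hσ1 hU hBrev hBB hC hCp0 hCpS hθ0 hdec g hg0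
  have hUU := resolventKernel_form_ge_normSq hπ hA0 hA1 hrev hσ0 hσ1 hU g
  have e4 : ∑ x, π x * (∑ y, U x y * g y) ^ 2 = ∑ x, π x * f x ^ 2 := sum_congr rfl fun x _ => by rw [hUg x]
  rw [e1, e2, e3]
  rw [e4] at hUU
  have hθ' : 0 ≤ 1 - θ := sub_nonneg.mpr hθ1
  have h1 : (1 - θ) * ∑ x, π x * f x ^ 2 ≤ (1 - θ) * (∑ x, π x * g x * ∑ y, U x y * g y) := mul_le_mul_of_nonneg_left hUU hθ'
  have h2 : (1 - θ) * (∑ x, π x * g x * ∑ y, U x y * g y) ≤ (∑ x, π x * g x * ∑ y, U x y * g y) - ∑ x, π x * (∑ y, B x y * ∑ w, U y w * g w) ^ 2 := by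
    linarith [hform]
  calc (1 - σ) * (1 - θ) * ∑ x, π x * f x ^ 2 = (1 - σ) * ((1 - θ) * ∑ x, π x * f x ^ 2) := by ring
    _ ≤ (1 - σ) * ((∑ x, π x * g x * ∑ y, U x y * g y) - ∑ x, π x * (∑ y, B x y * ∑ w, U y w * g w) ^ 2) := mul_le_mul_of_nonneg_left (h1.trans h2) h1σ.le

omit [DecidableEq X] in
/-- **`⟨f,Sf⟩_π ≥ −σ‖f‖²_π`** for `S = σA + (1−σ)B` (`B` reversible and idempotent, `A ≥ 0` stochastic reversible). [ours] -/
theorem stepChain_form_ge_neg (hπ : ∀ x, 0 < π x) (hA0 : ∀ x y, 0 ≤ A x y) (hA1 : ∀ x, ∑ y, A x y = 1) (hrev : ∀ x y, π x * A x y = π y * A y x)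
    (hσ0 : 0 ≤ σ) (hσ1 : σ < 1) (hBrev : ∀ x y, π x * B x y = π y * B y x) (hBB : ∀ x y, ∑ z, B x z * B z y = B x y)
    (hS : ∀ x y, S x y = σ * A x y + (1 - σ) * B x y) (f : X → ℝ) :
    -(σ * ∑ x, π x * f x ^ 2) ≤ ∑ x, π x * f x * ∑ y, S x y * f y := by
  have eS : ∀ x, ∑ y, S x y * f y = σ * ∑ y, A x y * f y + (1 - σ) * ∑ y, B x y * f y := fun x => by
    rw [mul_sum, mul_sum, ← sum_add_distrib]; exact sum_congr rfl fun y _ => by rw [hS]; ring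
  have e : ∑ x, π x * f x * ∑ y, S x y * f y = σ * ∑ x, π x * f x * ∑ y, A x y * f y + (1 - σ) * ∑ x, π x * f x * ∑ y, B x y * f y := by
    rw [mul_sum, mul_sum, ← sum_add_distrib]; exact sum_congr rfl fun x _ => by rw [eS x]; ring
  have hA := kernel_form_ge_neg hrev hA0 hA1 (fun x => (hπ x).le) f
  have hB : 0 ≤ ∑ x, π x * f x * ∑ y, B x y * f y := by
    rw [idem_form_eq_normSq hBrev hBB f]; exact sum_nonneg fun x _ => mul_nonneg (hπ x).le (sq_nonneg _)
  have h1σ : 0 ≤ 1 - σ := by linarith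
  rw [e]
  nlinarith [mul_le_mul_of_nonneg_left hA hσ0, mul_nonneg h1σ hB]

/-- **EIGENVALUE BOUNDS FOR THE STEP CHAIN:** under the hypotheses of `stepChain_dirichlet_ge`, a real eigenfunction `Sf = λf` with `Σπf = 0` and `f ≠ 0` has
**`−σ ≤ λ ≤ 1 − (1−σ)(1−θ)`**. [ours] -/
theorem stepChain_eigenvalue_bounds [Nonempty X] (hπ : ∀ x, 0 < π x) (hA0 : ∀ x y, 0 ≤ A x y) (hA1 : ∀ x, ∑ y, A x y = 1) (hrev : ∀ x y, π x * A x y = π y * A y x)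
    (hσ0 : 0 ≤ σ) (hσ1 : σ < 1) (hU : ∀ x y, U x y = (1 - σ) * (if x = y then 1 else 0) + σ * ∑ z, A x z * U z y)
    (hBrev : ∀ x y, π x * B x y = π y * B y x) (hBB : ∀ x y, ∑ z, B x z * B z y = B x y)
    (hC : ∀ x y, C x y = ∑ z, U x z * B z y) (hCp0 : ∀ x y, Cp 0 x y = if x = y then 1 else 0) (hCpS : ∀ n x y, Cp (n + 1) x y = ∑ z, Cp n x z * C z y)
    (hθ0 : 0 < θ) (hθ1 : θ ≤ 1) (hdec : ∀ n x, ∑ y, |Cp n x y - πC y| ≤ 2 * C₀ * θ ^ n)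
    (hS : ∀ x y, S x y = σ * A x y + (1 - σ) * B x y) {f : X → ℝ} (hf0 : ∑ x, π x * f x = 0) (hfne : ∃ x, f x ≠ 0)
    {lam : ℝ} (heig : ∀ x, ∑ y, S x y * f y = lam * f x) :
    -σ ≤ lam ∧ lam ≤ 1 - (1 - σ) * (1 - θ) := by
  have hpos : 0 < ∑ x, π x * f x ^ 2 := by
    obtain ⟨x₀, hx₀⟩ := hfne
    exact lt_of_lt_of_le (mul_pos (hπ x₀) (by positivity)) (single_le_sum (fun x _ => mul_nonneg (hπ x).le (sq_nonneg (f x))) (mem_univ x₀))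
  have eq1 : ∑ x, π x * f x * ∑ y, S x y * f y = lam * ∑ x, π x * f x ^ 2 := by
    rw [mul_sum]; exact sum_congr rfl fun x _ => by rw [heig x]; ring
  have eq2 : ∑ x, π x * f x * (f x - ∑ y, S x y * f y) = (1 - lam) * ∑ x, π x * f x ^ 2 := by
    rw [mul_sum]; exact sum_congr rfl fun x _ => by rw [heig x]; ring
  have hlo := stepChain_form_ge_neg hπ hA0 hA1 hrev hσ0 hσ1 hBrev hBB hS f
  have hhi := stepChain_dirichlet_ge hπ hA0 hA1 hrev hσ0 hσ1 hU hBrev hBB hC hCp0 hCpS hθ0 hθ1 hdec hS f hf0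
  rw [eq1] at hlo
  rw [eq2] at hhi
  constructor
  · nlinarith
  · nlinarith

end StepSpectral

end Summit.Ventures.LatticeQCDFlow.Scaling
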